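import Literature.Topology.FourManifolds.OpenTraceCollar
import Literature.Topology.FourManifolds.MMSWModelBoundaryRegular

/-!
# Helper `helper_friendsCarrier_Tk_trace` of stub `helper_friendsCarrier_Tk` — part 1: the gluing datum
(item stmt-SmoothPoincare4-16128, route route-SmoothPoincare4-DottedCircleRasmussen)

Piece (3) of the relative open trace `T_k` of the model dotted handlebody `D_k ⊂ ℝ⁴`
(`helper_friendsCarrier_Tk`, line `mk_friends`, crux `DcrGap`): the `k ≥ 1` analogue of the
tree's `OpenTrace.lean` (Manolescu–Piccirillo, Def. 3.4: the trace of a framed knot; Kirby 1989,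
Ch. I §2), in which the radial coordinate `t • a`, `a ∈ S³`, of `ℝ⁴ ∖ 0` is replaced by the
unit-speed COLLAR COORDINATE `θ(s, a)`, `a ∈ M_k = ∂D_k`, `|s| < δ`, of the model boundary
(`helper_friendsCarrier_Tk_collarFlow`: the clock `G_k(θ(s, a)) = 1 + s`), and the tube
`ν : 𝕊¹ × ℝ² ↪ S³` by a tube `ν : 𝕊¹ × ℝ² → M_k` of the model knot with tube coordinates `ι` on
its flow-out (`helper_friendsCarrier_Tk_tubeChart`).

* `FriendsTk.TraceDatum k` — the input bundle `(ν, θ, δ, ι)` with exactly the clauses produced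
  by pieces (1)–(2) (no new hypotheses: it is instantiated from them in part 2);
* `TraceDatum.hbNbhd` — the open neighbourhood `P = {|z - c_j|² > 1/2, G_k < 1 + δ} ⊇ D_k` of the
  handlebody (the `0`-handle side `A` of the gluing, an open submanifold of `ℝ⁴`);
* `TraceDatum.fwd` / `bwd` — the gluing maps `θ(s, ν(u, w)) ↦ (E(s) • u, w)`,
  `E(s) = (δ - s)/(δ + s)` (so `s = 0`, the knot level, is the unit circle `‖x‖ = 1` of the core
  plane; `s ↑ δ`, the end, is the cocore `x → 0`; `s ↓ -δ` is `‖x‖ → ∞`), and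
  `(x, w) ↦ θ(δ (1 - ‖x‖)/(1 + ‖x‖), ν(x/‖x‖, w))`; `bwd ∘ fwd = id` on the flowed-out tube,
  `fwd ∘ bwd = id` off `x = 0`; both `C^∞`;
* `TraceDatum.trGlue`, `trGlueData`, `Trace` — the partial diffeomorphism, the `SmoothGlueData`
  (`GluingConstruction.lean`) and the glued `C^∞` `4`-manifold `T = P ∪_glue (ℝ² × ℝ²)`
  (Hausdorffness, the charts `incl`/`inr` and the core disc follow in parts 2–3);
* `helper_friendsCarrier_Tk_glueMaps` — the registered summary: the two gluing maps are mutually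
  inverse `C^∞` maps between the flowed-out tube and `(ℝ² ∖ 0) × ℝ²`.

Everything is proved; the definitions are constructions, not named facts; no `sorry`.

References: Manolescu–Piccirillo, J. Lond. Math. Soc. 108 (2023), §3.2 Def. 3.4 [ManolescuPiccirillo2023];
Kirby, *The Topology of 4-Manifolds* (1989), Ch. I §2 [Kirby1989]; Kosinski, *Differential Manifolds* (1993), VI §1 [Kosinski1993].
-/

-- the prescribed namespace `Summit.<P>.<Sub>.…` duplicates `SmoothPoincare4` (P = Sub)
set_option linter.dupNamespace false
set_option linter.style.longLine false

noncomputable section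

open scoped Manifold ContDiff Topology
open Function Set Metric
open Literature.Topology.FourManifolds Literature.Topology.FourManifolds.MMSW

namespace Summit.SmoothPoincare4.SmoothPoincare4.Theorems.DcrGap.MkFriends

namespace FriendsTk

/-- **Trace datum** in the model `M_k ⊂ ℝ⁴`: a tube `ν : 𝕊¹ × ℝ² → M_k` (around the model knot
`ν(·, 0)`), a smooth flow `θ` of `ℝ⁴` with the unit-speed clock on the band
`{|z - c_j|² > 1/2, 1 - δ < G_k < 1 + δ}` (piece (1), `helper_friendsCarrier_Tk_collarFlow`), and
tube coordinates `ι` on the flowed-out tube (piece (2), `helper_friendsCarrier_Tk_tubeChart`).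
The fields are verbatim the conclusions of pieces (1)–(2). [folklore] -/
structure TraceDatum (k : ℕ) where
  /-- The tube of the knot in `M_k`. -/
  νK : (Metric.sphere (0 : EuclideanSpace ℝ (Fin 2)) 1) × (EuclideanSpace ℝ (Fin 2)) → (EuclideanSpace ℝ (Fin 4))
  /-- The collar flow of `M_k`. -/
  θ : ℝ × (EuclideanSpace ℝ (Fin 4)) → (EuclideanSpace ℝ (Fin 4))
  /-- The half-width of the clock band. -/
  δ : ℝ
  /-- The tube coordinates on the flowed-out tube. -/
  ι : (EuclideanSpace ℝ (Fin 4)) → (Metric.sphere (0 : EuclideanSpace ℝ (Fin 2)) 1) × (EuclideanSpace ℝ (Fin 2))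
  δ_pos : 0 < δ
  δ_lt_one : δ < 1
  contDiff_θ : ContDiff ℝ ∞ θ
  θ_zero : ∀ x, θ (0, x) = x
  θ_add : ∀ t s x, θ (t, θ (s, x)) = θ (t + s, x)
  clock : ∀ y : (EuclideanSpace ℝ (Fin 4)), (∀ j, (1 : ℝ) / 2 < holeTerm k j y) → levelFun k y ∈ Ioo (1 - δ) (1 + δ) →
    ∀ t : ℝ, levelFun k y + t ∈ Ioo (1 - δ) (1 + δ) →
      (∀ j, (1 : ℝ) / 2 < holeTerm k j (θ (t, y))) ∧ levelFun k (θ (t, y)) = levelFun k y + t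
  mem_modelHandlebody_iff : ∀ a ∈ modelBoundary k, ∀ s ∈ Ioo (-δ) δ, (θ (s, a) ∈ modelHandlebody k ↔ s ≤ 0)
  contMDiff_νK : ContMDiff ((𝓡 1).prod 𝓘(ℝ, (EuclideanSpace ℝ (Fin 2)))) 𝓘(ℝ, (EuclideanSpace ℝ (Fin 4))) ∞ νK
  νK_mem : ∀ p, νK p ∈ modelBoundary k
  isOpen_flowTube' : IsOpen {y : (EuclideanSpace ℝ (Fin 4)) | (∀ j, (1 : ℝ) / 2 < holeTerm k j y) ∧
    levelFun k y ∈ Ioo (1 - δ) (1 + δ) ∧ θ (1 - levelFun k y, y) ∈ range νK}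
  contMDiffOn_ι : ContMDiffOn 𝓘(ℝ, (EuclideanSpace ℝ (Fin 4))) ((𝓡 1).prod 𝓘(ℝ, (EuclideanSpace ℝ (Fin 2)))) ∞ ι {y : (EuclideanSpace ℝ (Fin 4)) |
    (∀ j, (1 : ℝ) / 2 < holeTerm k j y) ∧ levelFun k y ∈ Ioo (1 - δ) (1 + δ) ∧
      θ (1 - levelFun k y, y) ∈ range νK}
  ι_θ : ∀ (q : (Metric.sphere (0 : EuclideanSpace ℝ (Fin 2)) 1) × (EuclideanSpace ℝ (Fin 2))) (s : ℝ), s ∈ Ioo (-δ) δ → ι (θ (s, νK q)) = q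
  θ_ι : ∀ y ∈ {y : (EuclideanSpace ℝ (Fin 4)) | (∀ j, (1 : ℝ) / 2 < holeTerm k j y) ∧ levelFun k y ∈ Ioo (1 - δ) (1 + δ) ∧
    θ (1 - levelFun k y, y) ∈ range νK}, θ (levelFun k y - 1, νK (ι y)) = y

namespace TraceDatum

variable {k : ℕ} (D : TraceDatum k)

/-! ### The radius/time exchange `E(s) = (δ - s)/(δ + s)`, `s(r) = δ (1 - r)/(1 + r)` -/

/-- The core-plane radius `E(s) = (δ - s)/(δ + s)` of the collar time `s` (`E(0) = 1`, `E ↓ 0` as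
`s ↑ δ`, `E ↑ ∞` as `s ↓ -δ`). [folklore] -/
def handleRadius (s : ℝ) : ℝ := (D.δ - s) / (D.δ + s)

/-- The collar time `s(r) = δ (1 - r)/(1 + r)` of the core-plane radius `r` (inverse of `E`).
[folklore] -/
def collarTime (r : ℝ) : ℝ := D.δ * (1 - r) / (1 + r)

/-- `s (E s) = s` for `|s| < δ`. [folklore] -/
theorem collarTime_handleRadius {s : ℝ} (hs : s ∈ Ioo (-D.δ) D.δ) : D.collarTime (D.handleRadius s) = s := by
  have h1 : 0 < D.δ + s := by linarith [hs.1]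
  have hδ : D.δ ≠ 0 := D.δ_pos.ne'
  have h2 : (D.δ + s) + (D.δ - s) = 2 * D.δ := by ring
  have h3 : (D.δ + s) - (D.δ - s) = 2 * s := by ring
  rw [collarTime, handleRadius, one_sub_div h1.ne', one_add_div h1.ne', h2, h3, mul_div_assoc]
  rw [div_div_div_cancel_right₀ h1.ne']
  field_simp

/-- `E (s r) = r` for `r ≥ 0`. [folklore] -/
theorem handleRadius_collarTime {r : ℝ} (hr : 0 ≤ r) : D.handleRadius (D.collarTime r) = r := by
  have hδ := D.δ_pos
  have h1 : (0 : ℝ) < 1 + r := by linarith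
  rw [collarTime, handleRadius]
  field_simp
  ring

/-- `E s > 0` for `|s| < δ`. [folklore] -/
theorem handleRadius_pos {s : ℝ} (hs : s ∈ Ioo (-D.δ) D.δ) : 0 < D.handleRadius s :=
  div_pos (by linarith [hs.2]) (by linarith [hs.1])

/-- `s(r) ∈ (-δ, δ)` for `r > 0`. [folklore] -/
theorem collarTime_mem_Ioo {r : ℝ} (hr : 0 < r) : D.collarTime r ∈ Ioo (-D.δ) D.δ := by
  have hδ := D.δ_pos
  have h1 : (0 : ℝ) < 1 + r := by linarith
  rw [collarTime]
  constructor
  · rw [lt_div_iff₀ h1]; nlinarith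
  · rw [div_lt_iff₀ h1]; nlinarith

/-- `s(r) ≤ 0 ↔ 1 ≤ r` (`r ≥ 0`): the handlebody side is `‖x‖ ≥ 1`. [folklore] -/
theorem collarTime_nonpos_iff {r : ℝ} (hr : 0 ≤ r) : D.collarTime r ≤ 0 ↔ 1 ≤ r := by
  have hδ := D.δ_pos
  have h1 : (0 : ℝ) < 1 + r := by linarith
  rw [collarTime, div_nonpos_iff]
  constructor
  · rintro (⟨-, h⟩ | ⟨h, -⟩)
    · linarith
    · by_contra hlt
      push Not at hlt
      have := mul_pos hδ (sub_pos.2 hlt)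
      linarith
  · intro h; exact Or.inr ⟨by nlinarith, h1.le⟩

/-! ### The flow identities -/

/-- `θ(-s, θ(s, x)) = x`. [folklore] -/
theorem θ_neg_θ (s : ℝ) (x : (EuclideanSpace ℝ (Fin 4))) : D.θ (-s, D.θ (s, x)) = x := by
  rw [D.θ_add, neg_add_cancel, D.θ_zero]

/-- The tube lies in the band: the clock along `θ(·, ν q)`. [folklore] -/
theorem clock_νK (q : (Metric.sphere (0 : EuclideanSpace ℝ (Fin 2)) 1) × (EuclideanSpace ℝ (Fin 2))) {s : ℝ} (hs : s ∈ Ioo (-D.δ) D.δ) :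
    (∀ j, (1 : ℝ) / 2 < holeTerm k j (D.θ (s, D.νK q))) ∧ levelFun k (D.θ (s, D.νK q)) = 1 + s := by
  have hm := D.νK_mem q
  have hg : ∀ j, (1 : ℝ) / 2 < holeTerm k j (D.νK q) := fun j => lt_of_lt_of_le (by norm_num) (hm.1 j)
  have hG : levelFun k (D.νK q) ∈ Ioo (1 - D.δ) (1 + D.δ) := by
    rw [hm.2]; exact ⟨by linarith [D.δ_pos], by linarith [D.δ_pos]⟩
  have h := D.clock (D.νK q) hg hG s (by rw [hm.2]; exact ⟨by linarith [hs.1], by linarith [hs.2]⟩)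
  rw [hm.2] at h
  exact h

/-! ### The `0`-handle side `P` and the flowed-out tube -/

/-- The `0`-handle side of the gluing: the open neighbourhood
`P = {|z - c_j|² > 1/2, G_k < 1 + δ}` of `D_k` in `ℝ⁴`. [folklore] -/
def hbNbhd : Set (EuclideanSpace ℝ (Fin 4)) := {y | (∀ j, (1 : ℝ) / 2 < holeTerm k j y) ∧ levelFun k y < 1 + D.δ}

/-- `P` is open. [folklore] -/
theorem isOpen_hbNbhd : IsOpen D.hbNbhd :=
  ((continuousOn_levelFun (r := k) (by norm_num : (0 : ℝ) < 1 / 2)).mono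
    (fun y (hy : ∀ j : Fin k, (1 : ℝ) / 2 < holeTerm k j y) j => le_of_lt (hy j))).isOpen_inter_preimage
    (isOpen_guard (1 / 2)) isOpen_Iio

/-- `D_k ⊆ P`. [folklore] -/
theorem modelHandlebody_subset_hbNbhd : modelHandlebody k ⊆ D.hbNbhd := fun _ hy =>
  ⟨fun j => lt_of_lt_of_le (by norm_num) (hy.1 j), by linarith [hy.2, D.δ_pos]⟩

/-- `P` as an open submanifold of `ℝ⁴`. [folklore] -/
def hbOpens : TopologicalSpace.Opens (EuclideanSpace ℝ (Fin 4)) := ⟨D.hbNbhd, D.isOpen_hbNbhd⟩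

/-- Membership in `hbOpens`. [folklore] -/
@[simp] theorem mem_hbOpens {y : (EuclideanSpace ℝ (Fin 4))} : y ∈ D.hbOpens ↔ y ∈ D.hbNbhd := Iff.rfl

/-- The flowed-out tube `R = {θ(s, ν q) | |s| < δ}` (described intrinsically), the gluing region on
the `0`-handle side. [folklore] -/
def flowTube : Set (EuclideanSpace ℝ (Fin 4)) := {y | (∀ j, (1 : ℝ) / 2 < holeTerm k j y) ∧
  levelFun k y ∈ Ioo (1 - D.δ) (1 + D.δ) ∧ D.θ (1 - levelFun k y, y) ∈ range D.νK}

/-- The flowed-out tube is open. [folklore] -/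
theorem isOpen_flowTube : IsOpen D.flowTube := D.isOpen_flowTube'

/-- The flowed-out tube lies in `P`. [folklore] -/
theorem flowTube_subset_hbNbhd : D.flowTube ⊆ D.hbNbhd := fun _ hy => ⟨hy.1, hy.2.1.2⟩

/-- Points `θ(s, ν q)`, `|s| < δ`, lie in the flowed-out tube. [folklore] -/
theorem θ_νK_mem_flowTube (q : (Metric.sphere (0 : EuclideanSpace ℝ (Fin 2)) 1) × (EuclideanSpace ℝ (Fin 2))) {s : ℝ} (hs : s ∈ Ioo (-D.δ) D.δ) : D.θ (s, D.νK q) ∈ D.flowTube := by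
  obtain ⟨hg, hG⟩ := D.clock_νK q hs
  refine ⟨hg, by rw [hG]; exact ⟨by linarith [hs.1], by linarith [hs.2]⟩, ?_⟩
  rw [hG, show 1 - (1 + s) = -s by ring, D.θ_neg_θ]
  exact mem_range_self q

/-- Every point of the flowed-out tube is `θ(s, ν q)` with `s = G_k - 1`, `q = ι`. [folklore] -/
theorem eq_θ_νK {y : (EuclideanSpace ℝ (Fin 4))} (hy : y ∈ D.flowTube) :
    y = D.θ (levelFun k y - 1, D.νK (D.ι y)) ∧ levelFun k y - 1 ∈ Ioo (-D.δ) D.δ :=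
  ⟨(D.θ_ι y hy).symm, by constructor <;> linarith [hy.2.1.1, hy.2.1.2]⟩

/-! ### The gluing maps -/

/-- The **forward gluing map** `ℝ⁴ → ℝ² × ℝ²`: `θ(s, ν(u, w)) ↦ (E(s) • u, w)` (junk off the
flowed-out tube). [folklore] -/
def fwd (y : (EuclideanSpace ℝ (Fin 4))) : (EuclideanSpace ℝ (Fin 2)) × (EuclideanSpace ℝ (Fin 2)) :=
  (D.handleRadius (levelFun k y - 1) • ((D.ι y).1 : (EuclideanSpace ℝ (Fin 2))), (D.ι y).2)

/-- The **backward gluing map** `ℝ² × ℝ² → ℝ⁴`: `(x, w) ↦ θ(δ(1 - ‖x‖)/(1 + ‖x‖), ν(x/‖x‖, w))`.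
[folklore] -/
def bwd (p : (EuclideanSpace ℝ (Fin 2)) × (EuclideanSpace ℝ (Fin 2))) : (EuclideanSpace ℝ (Fin 4)) :=
  D.θ (D.collarTime ‖p.1‖, D.νK (radialProjection (spherePt 1) p.1, p.2))

/-- The forward map on `θ(s, ν q)`. [folklore] -/
theorem fwd_θ_νK (q : (Metric.sphere (0 : EuclideanSpace ℝ (Fin 2)) 1) × (EuclideanSpace ℝ (Fin 2))) {s : ℝ} (hs : s ∈ Ioo (-D.δ) D.δ) :
    D.fwd (D.θ (s, D.νK q)) = (D.handleRadius s • (q.1 : (EuclideanSpace ℝ (Fin 2))), q.2) := by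
  rw [fwd, (D.clock_νK q hs).2, D.ι_θ q s hs, add_sub_cancel_left]

/-- The backward map on `(t • u, w)`, `t > 0`. [folklore] -/
theorem bwd_smul {t : ℝ} (ht : 0 < t) (u : (Metric.sphere (0 : EuclideanSpace ℝ (Fin 2)) 1)) (w : (EuclideanSpace ℝ (Fin 2))) :
    D.bwd (t • (u : (EuclideanSpace ℝ (Fin 2))), w) = D.θ (D.collarTime t, D.νK (u, w)) := by
  simp only [bwd, radialProjection_smul _ ht, norm_smul_coe_sphere ht.le]

/-- `G_k (bwd (x, w)) = 1 + δ(1 - ‖x‖)/(1 + ‖x‖)` for `x ≠ 0`. [folklore] -/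
theorem levelFun_bwd {p : (EuclideanSpace ℝ (Fin 2)) × (EuclideanSpace ℝ (Fin 2))} (hp : p.1 ≠ 0) : levelFun k (D.bwd p) = 1 + D.collarTime ‖p.1‖ :=
  (D.clock_νK _ (D.collarTime_mem_Ioo (norm_pos_iff.2 hp))).2

/-- `bwd ∘ fwd = id` on the flowed-out tube. [folklore] -/
theorem bwd_fwd {y : (EuclideanSpace ℝ (Fin 4))} (hy : y ∈ D.flowTube) : D.bwd (D.fwd y) = y := by
  obtain ⟨hyeq, hs⟩ := D.eq_θ_νK hy
  set s := levelFun k y - 1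
  set q := D.ι y
  rw [hyeq, D.fwd_θ_νK q hs, D.bwd_smul (D.handleRadius_pos hs), D.collarTime_handleRadius hs]

/-- `fwd ∘ bwd = id` off `x = 0`. [folklore] -/
theorem fwd_bwd {p : (EuclideanSpace ℝ (Fin 2)) × (EuclideanSpace ℝ (Fin 2))} (hp : p.1 ≠ 0) : D.fwd (D.bwd p) = p := by
  obtain ⟨x, w⟩ := p
  have hpos : 0 < ‖x‖ := norm_pos_iff.2 hp
  have hx : x = ‖x‖ • ((radialProjection (spherePt 1) x : (Metric.sphere (0 : EuclideanSpace ℝ (Fin 2)) 1)) : (EuclideanSpace ℝ (Fin 2))) :=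
    (norm_smul_coe_radialProjection _ x).symm
  conv_lhs => rw [hx]
  rw [D.bwd_smul hpos, D.fwd_θ_νK _ (D.collarTime_mem_Ioo hpos), D.handleRadius_collarTime hpos.le, ← hx]

/-- The backward map lands in the flowed-out tube. [folklore] -/
theorem bwd_mem_flowTube {p : (EuclideanSpace ℝ (Fin 2)) × (EuclideanSpace ℝ (Fin 2))} (hp : p.1 ≠ 0) : D.bwd p ∈ D.flowTube :=
  D.θ_νK_mem_flowTube _ (D.collarTime_mem_Ioo (norm_pos_iff.2 hp))

/-- The forward map lands off `x = 0`. [folklore] -/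
theorem fwd_fst_ne_zero {y : (EuclideanSpace ℝ (Fin 4))} (hy : y ∈ D.flowTube) : (D.fwd y).1 ≠ 0 := by
  obtain ⟨hyeq, hs⟩ := D.eq_θ_νK hy
  rw [hyeq, D.fwd_θ_νK _ hs]
  exact smul_ne_zero (D.handleRadius_pos hs).ne' (ne_zero_of_mem_unit_sphere _)

/-! ### Smoothness of the gluing maps -/

/-- **The forward map is smooth on the flowed-out tube.** [folklore] -/
theorem contMDiffOn_fwd : ContMDiffOn 𝓘(ℝ, (EuclideanSpace ℝ (Fin 4))) 𝓘(ℝ, (EuclideanSpace ℝ (Fin 2)) × (EuclideanSpace ℝ (Fin 2))) ∞ D.fwd D.flowTube := by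
  haveI : Fact (Module.finrank ℝ (EuclideanSpace ℝ (Fin 2)) = 1 + 1) := ⟨by simp⟩
  have h1 : ContMDiffOn 𝓘(ℝ, (EuclideanSpace ℝ (Fin 4))) 𝓘(ℝ, (EuclideanSpace ℝ (Fin 2))) ∞ (fun y ↦ (((D.ι y).1 : (Metric.sphere (0 : EuclideanSpace ℝ (Fin 2)) 1)) : (EuclideanSpace ℝ (Fin 2)))) D.flowTube :=
    ((contMDiff_coe_sphere (E := (EuclideanSpace ℝ (Fin 2))) (n := 1)).comp contMDiff_fst).comp_contMDiffOn D.contMDiffOn_ι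
  have h2 : ContMDiffOn 𝓘(ℝ, (EuclideanSpace ℝ (Fin 4))) 𝓘(ℝ, (EuclideanSpace ℝ (Fin 2))) ∞ (fun y ↦ (D.ι y).2) D.flowTube :=
    contMDiff_snd.comp_contMDiffOn D.contMDiffOn_ι
  have h3 : ContMDiffOn 𝓘(ℝ, (EuclideanSpace ℝ (Fin 4))) 𝓘(ℝ, ℝ) ∞ (fun y : (EuclideanSpace ℝ (Fin 4)) ↦ D.handleRadius (levelFun k y - 1)) D.flowTube := by
    intro y hy
    have h0 : ∀ j, holeTerm k j y ≠ 0 := fun j => (lt_trans (by norm_num) (hy.1 j)).ne'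
    have hden : D.δ + (levelFun k y - 1) ≠ 0 := by linarith [hy.2.1.1]
    have : ContDiffAt ℝ ∞ (fun y : (EuclideanSpace ℝ (Fin 4)) ↦ D.handleRadius (levelFun k y - 1)) y := by
      simp only [handleRadius]
      exact (contDiffAt_const.sub ((contDiffAt_levelFun h0).sub contDiffAt_const)).div
        (contDiffAt_const.add ((contDiffAt_levelFun h0).sub contDiffAt_const)) hden
    exact this.contMDiffAt.contMDiffWithinAt
  have hsm : ContDiff ℝ ∞ (fun p : ℝ × (EuclideanSpace ℝ (Fin 2)) ↦ p.1 • p.2) := contDiff_fst.smul contDiff_snd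
  exact (hsm.contMDiff.comp_contMDiffOn (h3.prodMk_space h1)).prodMk_space h2

/-- **The backward map is smooth off `x = 0`.** [folklore] -/
theorem contMDiffOn_bwd : ContMDiffOn 𝓘(ℝ, (EuclideanSpace ℝ (Fin 2)) × (EuclideanSpace ℝ (Fin 2))) 𝓘(ℝ, (EuclideanSpace ℝ (Fin 4))) ∞ D.bwd {p | p.1 ≠ 0} := by
  have hfst : ContMDiff 𝓘(ℝ, (EuclideanSpace ℝ (Fin 2)) × (EuclideanSpace ℝ (Fin 2))) 𝓘(ℝ, (EuclideanSpace ℝ (Fin 2))) ∞ (Prod.fst : (EuclideanSpace ℝ (Fin 2)) × (EuclideanSpace ℝ (Fin 2)) → (EuclideanSpace ℝ (Fin 2))) :=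
    contDiff_fst.contMDiff
  have hsnd : ContMDiff 𝓘(ℝ, (EuclideanSpace ℝ (Fin 2)) × (EuclideanSpace ℝ (Fin 2))) 𝓘(ℝ, (EuclideanSpace ℝ (Fin 2))) ∞ (Prod.snd : (EuclideanSpace ℝ (Fin 2)) × (EuclideanSpace ℝ (Fin 2)) → (EuclideanSpace ℝ (Fin 2))) :=
    contDiff_snd.contMDiff
  have hP : ContMDiffOn 𝓘(ℝ, (EuclideanSpace ℝ (Fin 2)) × (EuclideanSpace ℝ (Fin 2))) ((𝓡 1).prod 𝓘(ℝ, (EuclideanSpace ℝ (Fin 2)))) ∞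
      (fun p : (EuclideanSpace ℝ (Fin 2)) × (EuclideanSpace ℝ (Fin 2)) ↦ (radialProjection (spherePt 1) p.1, p.2)) {p | p.1 ≠ 0} :=
    ((contMDiffOn_radialProjection (spherePt 1)).comp hfst.contMDiffOn fun p hp ↦ hp).prodMk
      hsnd.contMDiffOn
  have hν : ContMDiffOn 𝓘(ℝ, (EuclideanSpace ℝ (Fin 2)) × (EuclideanSpace ℝ (Fin 2))) 𝓘(ℝ, (EuclideanSpace ℝ (Fin 4))) ∞
      (fun p : (EuclideanSpace ℝ (Fin 2)) × (EuclideanSpace ℝ (Fin 2)) ↦ D.νK (radialProjection (spherePt 1) p.1, p.2)) {p | p.1 ≠ 0} :=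
    D.contMDiff_νK.comp_contMDiffOn hP
  have h3 : ContMDiffOn 𝓘(ℝ, (EuclideanSpace ℝ (Fin 2)) × (EuclideanSpace ℝ (Fin 2))) 𝓘(ℝ, ℝ) ∞ (fun p : (EuclideanSpace ℝ (Fin 2)) × (EuclideanSpace ℝ (Fin 2)) ↦ D.collarTime ‖p.1‖)
      {p | p.1 ≠ 0} := by
    intro p hp
    have hn : ContDiffAt ℝ ∞ (fun p : (EuclideanSpace ℝ (Fin 2)) × (EuclideanSpace ℝ (Fin 2)) ↦ ‖p.1‖) p :=
      (contDiffAt_norm ℝ (hp : p.1 ≠ 0)).comp p contDiffAt_fst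
    have hden : 1 + ‖p.1‖ ≠ 0 := by positivity
    have : ContDiffAt ℝ ∞ (fun p : (EuclideanSpace ℝ (Fin 2)) × (EuclideanSpace ℝ (Fin 2)) ↦ D.collarTime ‖p.1‖) p := by
      simp only [collarTime]
      exact (contDiffAt_const.mul (contDiffAt_const.sub hn)).div (contDiffAt_const.add hn) hden
    exact this.contMDiffAt.contMDiffWithinAt
  exact D.contDiff_θ.contMDiff.comp_contMDiffOn (h3.prodMk_space hν)

/-! ### The gluing partial diffeomorphism and the glued manifold -/

/-- A base point of `P` (on the knot). [folklore] -/
def basePt : D.hbOpens :=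
  ⟨D.νK (spherePt 1, 0), D.modelHandlebody_subset_hbNbhd (modelBoundary_subset_modelHandlebody (D.νK_mem _))⟩

/-- **The gluing partial diffeomorphism**: the flowed-out tube in `P` onto `(ℝ² ∖ 0) × ℝ²`.
[folklore] -/
def trGlue : OpenPartialHomeomorph D.hbOpens ((EuclideanSpace ℝ (Fin 2)) × (EuclideanSpace ℝ (Fin 2))) where
  toFun a := D.fwd a
  invFun p := TubeNbhd.toOpens' D.hbOpens D.basePt (D.bwd p)
  source := Subtype.val ⁻¹' D.flowTube
  target := {p | p.1 ≠ 0}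
  map_source' _ ha := D.fwd_fst_ne_zero ha
  map_target' p hp := by
    show (TubeNbhd.toOpens' D.hbOpens D.basePt (D.bwd p) : (EuclideanSpace ℝ (Fin 4))) ∈ D.flowTube
    rw [TubeNbhd.coe_toOpens'_of_mem _ (D.flowTube_subset_hbNbhd (D.bwd_mem_flowTube hp))]
    exact D.bwd_mem_flowTube hp
  left_inv' a ha := by
    apply Subtype.ext
    rw [TubeNbhd.coe_toOpens'_of_mem _ (by rw [D.bwd_fwd ha]; exact a.2)]
    exact D.bwd_fwd ha
  right_inv' p hp := by
    show D.fwd (TubeNbhd.toOpens' D.hbOpens D.basePt (D.bwd p) : (EuclideanSpace ℝ (Fin 4))) = p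
    rw [TubeNbhd.coe_toOpens'_of_mem _ (D.flowTube_subset_hbNbhd (D.bwd_mem_flowTube hp))]
    exact D.fwd_bwd hp
  open_source := D.isOpen_flowTube.preimage continuous_subtype_val
  open_target := isOpen_ne.preimage continuous_fst
  continuousOn_toFun := D.contMDiffOn_fwd.continuousOn.comp continuous_subtype_val.continuousOn fun _ ha ↦ ha
  continuousOn_invFun := (TubeNbhd.contMDiffOn_toOpens' (I := 𝓘(ℝ, (EuclideanSpace ℝ (Fin 4)))) D.hbOpens D.basePt).continuousOn.comp
    D.contMDiffOn_bwd.continuousOn fun _ hp ↦ D.flowTube_subset_hbNbhd (D.bwd_mem_flowTube hp)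

/-- The source of the gluing map is the flowed-out tube. [folklore] -/
@[simp] theorem trGlue_source : D.trGlue.source = Subtype.val ⁻¹' D.flowTube := rfl

/-- The target of the gluing map is `(ℝ² ∖ 0) × ℝ²`. [folklore] -/
@[simp] theorem trGlue_target : D.trGlue.target = {p : (EuclideanSpace ℝ (Fin 2)) × (EuclideanSpace ℝ (Fin 2)) | p.1 ≠ 0} := rfl

/-- The gluing map is `fwd`. [folklore] -/
@[simp] theorem trGlue_apply (a : D.hbOpens) : D.trGlue a = D.fwd a := rfl

/-- The inverse gluing map is `bwd` (coerced, on the target). [folklore] -/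
theorem coe_trGlue_symm_apply {p : (EuclideanSpace ℝ (Fin 2)) × (EuclideanSpace ℝ (Fin 2))} (hp : p.1 ≠ 0) : (D.trGlue.symm p : (EuclideanSpace ℝ (Fin 4))) = D.bwd p :=
  TubeNbhd.coe_toOpens'_of_mem _ (D.flowTube_subset_hbNbhd (D.bwd_mem_flowTube hp))

/-- **The gluing datum of the relative open trace**: `P ⊇ D_k` glued to the `2`-handle chart
`ℝ² × ℝ²` along the flowed-out tube. [folklore] -/
def trGlueData : SmoothGlueData (𝓡 4) 𝓘(ℝ, (EuclideanSpace ℝ (Fin 2)) × (EuclideanSpace ℝ (Fin 2))) D.hbOpens ((EuclideanSpace ℝ (Fin 2)) × (EuclideanSpace ℝ (Fin 2))) (EuclideanSpace ℝ (Fin 4)) where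
  glue := D.trGlue
  contMDiffOn_glue := D.contMDiffOn_fwd.comp contMDiff_subtype_val.contMDiffOn fun _ ha ↦ ha
  contMDiffOn_glue_symm := (TubeNbhd.contMDiffOn_toOpens' (I := 𝓘(ℝ, (EuclideanSpace ℝ (Fin 4)))) D.hbOpens D.basePt).comp
    D.contMDiffOn_bwd fun _ hp ↦ D.flowTube_subset_hbNbhd (D.bwd_mem_flowTube hp)
  linA := ContinuousLinearEquiv.refl ℝ (EuclideanSpace ℝ (Fin 4))
  linB := TubeNbhd.traceLinB

/-- The gluing map of the datum is `trGlue`. [folklore] -/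
@[simp] theorem trGlueData_glue : D.trGlueData.glue = D.trGlue := rfl

/-- **The relative open trace** `T = P ∪_glue (ℝ² × ℝ²)` of the model handlebody with a `2`-handle
along the framed model knot: a `C^∞` `4`-manifold charted on `ℝ⁴` (Manolescu–Piccirillo Def. 3.4
with `B⁴` replaced by `D_k`; Kirby 1989, Ch. I §2). [cite: ManolescuPiccirillo2023, §3.2 Def. 3.4] -/
abbrev Trace : Type := D.trGlueData.Glued

end TraceDatum

end FriendsTk

/-- **Helper `helper_friendsCarrier_Tk_glueMaps`** (registered on the crux item; piece (3a) of the
relative open trace `T_k` of stub `helper_friendsCarrier_Tk`): for the collar flow `θ` (piece (1))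
and tube coordinates `ι` on the flowed-out tube `R` of a tube `ν : 𝕊¹ × ℝ² → M_k` (piece (2)), the
two gluing maps of the trace — `fwd : θ(s, ν(u, w)) ↦ ((δ - s)/(δ + s) • u, w)` on `R` and
`bwd : (x, w) ↦ θ(δ(1 - ‖x‖)/(1 + ‖x‖), ν(x/‖x‖, w))` on `x ≠ 0` — are mutually inverse `C^∞` maps
(`bwd` landing in `R`, `fwd` landing off `x = 0`): the partial diffeomorphism along which the
`2`-handle chart `ℝ² × ℝ²` is glued to the neighbourhood `{G_k < 1 + δ}` of `D_k`
(Manolescu–Piccirillo Def. 3.4; Kirby 1989, Ch. I §2). [cite: Kirby1989, Ch. I §2] -/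
theorem helper_friendsCarrier_Tk_glueMaps : ∀ (k : ℕ) (νK : (sphere (0 : EuclideanSpace ℝ (Fin 2)) 1) × EuclideanSpace ℝ (Fin 2) → EuclideanSpace ℝ (Fin 4)) (θ : ℝ × EuclideanSpace ℝ (Fin 4) → EuclideanSpace ℝ (Fin 4)) (δ : ℝ) (ι : EuclideanSpace ℝ (Fin 4) → (sphere (0 : EuclideanSpace ℝ (Fin 2)) 1) × EuclideanSpace ℝ (Fin 2)), 0 < δ → δ < 1 → ContDiff ℝ ((⊤ : ℕ∞) : WithTop ℕ∞) θ → (∀ x, θ (0, x) = x) → (∀ t s x, θ (t, θ (s, x)) = θ (t + s, x)) → (∀ y : EuclideanSpace ℝ (Fin 4), (∀ j, (1 : ℝ) / 2 < holeTerm k j y) → levelFun k y ∈ Ioo (1 - δ) (1 + δ) → ∀ t : ℝ, levelFun k y + t ∈ Ioo (1 - δ) (1 + δ) → (∀ j, (1 : ℝ) / 2 < holeTerm k j (θ (t, y))) ∧ levelFun k (θ (t, y)) = levelFun k y + t) → (∀ a ∈ modelBoundary k, ∀ s ∈ Ioo (-δ) δ, (θ (s, a) ∈ modelHandlebody k ↔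 s ≤ 0)) → ContMDiff ((𝓡 1).prod 𝓘(ℝ, EuclideanSpace ℝ (Fin 2))) 𝓘(ℝ, EuclideanSpace ℝ (Fin 4)) ((⊤ : ℕ∞) : WithTop ℕ∞) νK → (∀ p, νK p ∈ modelBoundary k) → IsOpen {y : EuclideanSpace ℝ (Fin 4) | (∀ j, (1 : ℝ) / 2 < holeTerm k j y) ∧ levelFun k y ∈ Ioo (1 - δ) (1 + δ) ∧ θ (1 - levelFun k y, y) ∈ range νK} → ContMDiffOn 𝓘(ℝ, EuclideanSpace ℝ (Fin 4)) ((𝓡 1).prod 𝓘(ℝ, EuclideanSpace ℝ (Fin 2))) ((⊤ : ℕ∞) : WithTop ℕ∞) ι {y : EuclideanSpace ℝ (Fin 4) | (∀ j, (1 : ℝ) / 2 < holeTerm k j y) ∧ levelFun k y ∈ Ioo (1 - δ) (1 + δ) ∧ θ (1 - levelFun k y, y) ∈ range νK} → (∀ (q : (sphere (0 : EuclideanSpace ℝ (Fin 2)) 1) × EuclideanSpace ℝ (Fin 2)) (s : ℝ), s ∈ Ioo (-δ) δ → ι (θ (s, νK q)) = q) → (∀ y ∈ {y : EuclideanSpace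 ℝ (Fin 4) | (∀ j, (1 : ℝ) / 2 < holeTerm k j y) ∧ levelFun k y ∈ Ioo (1 - δ) (1 + δ) ∧ θ (1 - levelFun k y, y) ∈ range νK}, θ (levelFun k y - 1, νK (ι y)) = y) → (∀ y ∈ {y : EuclideanSpace ℝ (Fin 4) | (∀ j, (1 : ℝ) / 2 < holeTerm k j y) ∧ levelFun k y ∈ Ioo (1 - δ) (1 + δ) ∧ θ (1 - levelFun k y, y) ∈ range νK}, (((δ - (levelFun k y - 1)) / (δ + (levelFun k y - 1))) • ((ι y).1 : EuclideanSpace ℝ (Fin 2)), (ι y).2).1 ≠ 0 ∧ θ (δ * (1 - ‖((δ - (levelFun k y - 1)) / (δ + (levelFun k y - 1))) • ((ι y).1 : EuclideanSpace ℝ (Fin 2))‖) / (1 + ‖((δ - (levelFun k y - 1)) / (δ + (levelFun k y - 1))) • ((ι y).1 : EuclideanSpace ℝ (Fin 2))‖), νK (radialProjection (spherePt 1) (((δ - (levelFun k y - 1)) / (δ + (levelFun k y - 1))) • ((ι y).1 : EuclideanSpace ℝ (Fin 2))), (ι y).2)) = y) ∧ (∀ p : EuclideanSpace ℝ (Fin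 2) × EuclideanSpace ℝ (Fin 2), p.1 ≠ 0 → θ (δ * (1 - ‖p.1‖) / (1 + ‖p.1‖), νK (radialProjection (spherePt 1) p.1, p.2)) ∈ {y : EuclideanSpace ℝ (Fin 4) | (∀ j, (1 : ℝ) / 2 < holeTerm k j y) ∧ levelFun k y ∈ Ioo (1 - δ) (1 + δ) ∧ θ (1 - levelFun k y, y) ∈ range νK} ∧ (((δ - (levelFun k (θ (δ * (1 - ‖p.1‖) / (1 + ‖p.1‖), νK (radialProjection (spherePt 1) p.1, p.2))) - 1)) / (δ + (levelFun k (θ (δ * (1 - ‖p.1‖) / (1 + ‖p.1‖), νK (radialProjection (spherePt 1) p.1, p.2))) - 1))) • ((ι (θ (δ * (1 - ‖p.1‖) / (1 + ‖p.1‖), νK (radialProjection (spherePt 1) p.1, p.2)))).1 : EuclideanSpace ℝ (Fin 2)), (ι (θ (δ * (1 - ‖p.1‖) / (1 + ‖p.1‖), νK (radialProjection (spherePt 1) p.1, p.2)))).2) = p) ∧ ContMDiffOn 𝓘(ℝ, EuclideanSpace ℝ (Fin 4)) 𝓘(ℝ, EuclideanSpace ℝ (Fin 2) × EuclideanSpace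 ℝ (Fin 2)) ((⊤ : ℕ∞) : WithTop ℕ∞) (fun y : EuclideanSpace ℝ (Fin 4) => (((δ - (levelFun k y - 1)) / (δ + (levelFun k y - 1))) • ((ι y).1 : EuclideanSpace ℝ (Fin 2)), (ι y).2)) {y : EuclideanSpace ℝ (Fin 4) | (∀ j, (1 : ℝ) / 2 < holeTerm k j y) ∧ levelFun k y ∈ Ioo (1 - δ) (1 + δ) ∧ θ (1 - levelFun k y, y) ∈ range νK} ∧ ContMDiffOn 𝓘(ℝ, EuclideanSpace ℝ (Fin 2) × EuclideanSpace ℝ (Fin 2)) 𝓘(ℝ, EuclideanSpace ℝ (Fin 4)) ((⊤ : ℕ∞) : WithTop ℕ∞) (fun p : EuclideanSpace ℝ (Fin 2) × EuclideanSpace ℝ (Fin 2) => θ (δ * (1 - ‖p.1‖) / (1 + ‖p.1‖), νK (radialProjection (spherePt 1) p.1, p.2))) {p : EuclideanSpace ℝ (Fin 2) × EuclideanSpace ℝ (Fin 2) | p.1 ≠ 0} := by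
  intro k νK θ δ ι hδ hδ1 hθ h0 hadd hclock hiff hν hmem hopen hι hιθ hθι
  let D : FriendsTk.TraceDatum k := ⟨νK, θ, δ, ι, hδ, hδ1, hθ, h0, hadd, hclock, hiff, hν, hmem, hopen, hι, hιθ, hθι⟩
  refine ⟨fun y hy => ⟨D.fwd_fst_ne_zero hy, D.bwd_fwd hy⟩, fun p hp => ⟨D.bwd_mem_flowTube hp, D.fwd_bwd hp⟩,
    D.contMDiffOn_fwd, D.contMDiffOn_bwd⟩

end Summit.SmoothPoincare4.SmoothPoincare4.Theorems.DcrGap.MkFriends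

end
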